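import Summits.CriticalPhenomena.PercolationContinuityZ3.Theorems.SubpolynomialBlocking.Negative.OffCritical
import Summits.CriticalPhenomena.PercolationContinuityZ3.Theorems.PercNonProliferationNonProliferationStubLogLedger
import Summits.CriticalPhenomena.PercolationContinuityZ3.Theorems.PercNonProliferationFreeBoxPowerSavingPairGivesOneArm
import Literature.Probability.Percolation.ArmEvents
import Mathlib.Data.Nat.Log
import HarnessLib

/-!
# Crux `PercNonProliferation.FreeBoxPowerSaving` (stmt-CriticalPhenomena-4447), line `Sketch_r2_ideator4` (card `onearm-currency-arm-cauchy-schwarz`) — stub `stub_cesaroBlockingGivesOneArm`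

Helper file for the crux skeleton `Cruxes/FreeBoxPowerSaving/Lines/Sketch_r2_ideator4.lean`
(lead prover-line-stmt-CriticalPhenomena-4447-a2-0). Proves exactly the registered stub signature
`stub_cesaroBlockingGivesOneArm` (the ENGINE side of the line: "Cesàro blocking ⟹ polynomial
one-arm decay", for EVERY `p`); lands with `--supports stmt-CriticalPhenomena-4447`.

## The statement

Bond percolation `P_p` on `ℤ³`, `Λ_n = box 3 n`, `π_p(m) = oneArmProb 3 p m = P_p(0 ↔ ∂ⁱⁿΛ_m in Λ_m)`,
`u_n = u_n(p) = P_p(Λ_n ↮ ∂ⁱⁿΛ_{2n} in Λ_{2n}) = 1 - P_p(annulusCrossing 3 n)` (`blockProb 3 p n`). Then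

  `(∃ c > 0, ∀ᶠ K, c K ≤ Σ_{j<K} u_{2^j})  →  ∃ s > 0, C, ∀ m ≥ 1, π_p(m) ≤ C m^{-s}`.

## The argument

* **Multi-scale product bound** (`CesaroBlockingGivesOneArm.oneArmProb_two_pow_le_prod`, every `d`):
  `π_p(2^K) ≤ Π_{j<K} P_p(annulusCrossing d (2^j)) = Π_{j<K} (1 - u_{2^j})`.
  Classify the pairs of sites by scale: `E_j = Λ_{2^{j+1}}.sym2 ∖ Λ_{2^j}.sym2` (pairs inside
  `Λ_{2^{j+1}}` not both inside `Λ_{2^j}`); these finite sets are pairwise disjoint. The *pure* crossing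
  event `A_j = {ω | ω ∩ E_j ∈ annulusCrossing d (2^j)}` is determined by `E_j`, is contained in
  `annulusCrossing d (2^j)` (increasing event, `ω ∩ E_j ⊆ ω`), and the `A_j`, `j < K`, are independent
  (`DCT16.real_inter_of_determinedBy_disjoint`, inductively: `⋂_{j<K} A_j` is determined by
  `Λ_{2^K}.sym2`, disjoint from `E_K`). Finally `{0 ↔ ∂ⁱⁿΛ_{2^K} in Λ_{2^K}} ⊆ ⋂_{j<K} A_j` for lattice
  configurations (`CesaroBlockingGivesOneArm.mem_annulusCrossing_inter_of_pathIn`): an open path from `0`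
  to `∂ⁱⁿΛ_N` inside `Λ_N`, `2n ≤ N`, `1 ≤ n`, read from its LAST visit `a` to `Λ_n` (`PathIn.last_exit`)
  up to its FIRST subsequent visit `b'` to `∂ⁱⁿΛ_{2n}` (`PathIn.exit` from `Λ_{2n-1}`), is an open path
  `a → b → ⋯ → a' → b'` inside `Λ_{2n}` all of whose edges have an endpoint outside `Λ_n`, i.e. lie in
  `E = Λ_{2n}.sym2 ∖ Λ_n.sym2`; so it is open in `ω ∩ E`, and `ω ∩ E ∈ annulusCrossing d n`.
* **Analysis** (`1 - u ≤ e^{-u}`): `π_p(2^K) ≤ exp(-Σ_{j<K} u_{2^j}) ≤ e^{-cK} ≤ 2^{-cK} = (2^K)^{-c}`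
  for `K ≥ K₀`; for `2^K ≤ m < 2^{K+1}`, `π_p(m) ≤ π_p(2^K)` (`DCT16.real_siteToBoundary_antitone`)
  and `(2^K)^{-c} ≤ 2^c m^{-c}`; for `m < 2^{K₀}`, `π_p(m) ≤ 1 ≤ (2^{K₀})^c m^{-c}`. Hence `s = c`,
  `C = 2^c + (2^{K₀})^c`.

Tree API: `annulusCrossing`, `blockProb_eq`, `blockProb_le_one`, `DCT16.mem_siteToBoundary_iff`,
`DCT16.real_mono_of_forall_subset_edgeSet`, `DCT16.real_inter_of_determinedBy_disjoint`,
`DCT16.pathIn_congrGraph`, `DCT16.mem_openConnIn_of_pathIn`, `DCT16.adj_of_openGraph_adj`,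
`DCT16.mem_box_succ_of_adj`, `DCT16.mem_innerBoundary_box_of_natAbs_eq`,
`DCT16.notMem_box_of_mem_innerBoundary_box`, `DCT16.real_siteToBoundary_antitone`, `PathIn.last_exit`,
`PathIn.exit`, `DeterminedBy.iInter`, `DeterminedBy.mono`, `StubLogLedger.isUpperSet_annulusCrossing`,
`PairGivesOneArm.rpow_neg_le_of_le_mul` (sibling stub file of this line).
Mathlib: `Finset.sym2`, `Finset.sdiff_disjoint`, `Real.one_sub_le_exp_neg`, `Real.exp_sum`,
`Real.rpow_le_rpow_of_nonpos`, `Real.exp_one_rpow`, `Real.rpow_natCast_mul`, `Nat.log`.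
-/

noncomputable section

namespace Summit.CriticalPhenomena.PercolationContinuityZ3.FreeBoxPowerSavingLine

open MeasureTheory Filter
open Literature.Probability.Percolation Literature.Probability.LatticeModels
open Literature.Probability.Percolation.DCT16
open Literature.Barriers.CriticalPhenomena (annulusCrossing box_subset_box_two_mul)
open Summit.CriticalPhenomena.PercolationContinuityZ3.Theorems.SubpolynomialBlocking.Negative
  (blockProb blockProb_eq blockProb_le_one)
open Summit.CriticalPhenomena.PercolationContinuityZ3.Theorems.NonProliferation.StubLogLedger
  (isUpperSet_annulusCrossing)
open Summit.CriticalPhenomena.PercolationContinuityZ3.FreeBoxPowerSavingLine.PairGivesOneArm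
  (rpow_neg_le_of_le_mul)

namespace CesaroBlockingGivesOneArm

/-! ### Generic facts: events read on a fixed set of pairs, independence along a filtration -/

section Generic

variable {V : Type*}

/-- The event "`ω` restricted to `E` lies in `X`" is determined by the pairs in `E`. -/
theorem determinedBy_setOf_inter_mem (X : Set (BondConfig V)) (E : Set (Sym2 V)) :
    DeterminedBy {ω : BondConfig V | ω ∩ E ∈ X} E := by
  rw [determinedBy_iff]
  intro ω ω' h
  simp only [Set.mem_setOf_eq, h]

/-- For an increasing event `X`, "`ω ∩ E ∈ X`" implies "`ω ∈ X`" (`ω ∩ E ⊆ ω`). -/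
theorem setOf_inter_mem_subset {X : Set (BondConfig V)} (hX : IsUpperSet X) (E : Set (Sym2 V)) :
    {ω : BondConfig V | ω ∩ E ∈ X} ⊆ X :=
  fun _ hω => hX Set.inter_subset_left hω

/-- **Independence along a filtration of finite sets of pairs.** If `F : ℕ → Finset (Sym2 V)` is
monotone and the event `A j` is determined by the pairs of `F (j+1) ∖ F j`, then
`P_p(⋂_{j<K} A j) = Π_{j<K} P_p(A j)` (the sets `F (j+1) ∖ F j` are pairwise disjoint;
`DCT16.real_inter_of_determinedBy_disjoint`, inductively on `K`). -/
theorem real_biInter_range_eq_prod [DecidableEq V] [Countable V] (G : SimpleGraph V)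
    (p : unitInterval) {A : ℕ → Set (BondConfig V)} {F : ℕ → Finset (Sym2 V)} (hF : Monotone F)
    (hA : ∀ j, DeterminedBy (A j) ↑(F (j + 1) \ F j)) (K : ℕ) :
    (bondPercolation G p).real (⋂ j ∈ Finset.range K, A j) =
      ∏ j ∈ Finset.range K, (bondPercolation G p).real (A j) := by
  have hdet : ∀ K, DeterminedBy (⋂ j ∈ Finset.range K, A j) ↑(F K) := fun K =>
    DeterminedBy.iInter fun j => DeterminedBy.iInter fun hj => (hA j).mono
      (Finset.coe_subset.2 (Finset.sdiff_subset.trans (hF (Finset.mem_range.1 hj))))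
  induction K with
  | zero => simp
  | succ K ih =>
    rw [Finset.prod_range_succ, Finset.range_add_one, Finset.set_biInter_insert, ← ih, mul_comm]
    exact real_inter_of_determinedBy_disjoint G p (hA K) (hdet K) Finset.sdiff_disjoint

end Generic

/-! ### Geometry of `ℤ^d`: the scale of a pair, the pure annulus crossing of an arm -/

variable {d : ℕ}

/-- A site of `Λ_L` outside `Λ_m`, `L = m + 1`, lies on `∂ⁱⁿΛ_L`. -/
theorem mem_innerBoundary_box_of_notMem {L m : ℕ} (hm : m + 1 = L) {z : Site d}
    (hz : z ∈ box d L) (hzm : z ∉ box d m) : z ∈ innerBoundary (zdGraph d) (box d L) := by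
  rw [mem_box, not_forall] at hzm
  obtain ⟨i, hi⟩ := hzm
  have := (mem_box.1 hz) i
  exact mem_innerBoundary_box_of_natAbs_eq hz (i := i) (by omega)

/-- An open edge of `Λ_{2n}` with an endpoint outside `Λ_n` is open in the configuration restricted
to the pairs of scale `n`, `E = Λ_{2n}.sym2 ∖ Λ_n.sym2`. -/
theorem openGraph_inter_adj {ω : BondConfig (Site d)} {n : ℕ} {u v : Site d}
    (hu : u ∈ box d (2 * n)) (hv : v ∈ box d (2 * n)) (huv : u ∉ box d n ∨ v ∉ box d n)
    (h : (openGraph ω).Adj u v) :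
    (openGraph (ω ∩ ↑((box d (2 * n)).sym2 \ (box d n).sym2))).Adj u v := by
  rw [openGraph_adj] at h ⊢
  refine ⟨⟨h.1, ?_⟩, h.2⟩
  rw [Finset.mem_coe, Finset.mem_sdiff, Finset.mk_mem_sym2_iff, Finset.mk_mem_sym2_iff]
  exact ⟨⟨hu, hv⟩, fun h' => huv.elim (fun h => h h'.1) fun h => h h'.2⟩

/-- **The pure annulus crossing of an arm.** In a lattice configuration `ω ⊆ E(ℤ^d)`, an open path
inside `Λ_N` from `0` to `∂ⁱⁿΛ_N` crosses, for `1 ≤ n`, `2n ≤ N`, the annulus `Λ_{2n} ∖ Λ_n` using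
only open pairs of scale `n`: `ω ∩ (Λ_{2n}.sym2 ∖ Λ_n.sym2) ∈ annulusCrossing d n`. (From the last
visit `a` to `Λ_n` to the first subsequent visit to `∂ⁱⁿΛ_{2n}`, every edge of the path has an
endpoint outside `Λ_n` and both endpoints in `Λ_{2n}`.) -/
theorem mem_annulusCrossing_inter_of_pathIn {n N : ℕ} (hn : 1 ≤ n) (hN : 2 * n ≤ N)
    {ω : BondConfig (Site d)} (hω : ω ⊆ (zdGraph d).edgeSet) {y : Site d}
    (hy : y ∈ innerBoundary (zdGraph d) (box d N)) (h : PathIn (openGraph ω) ↑(box d N) 0 y) :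
    ω ∩ ↑((box d (2 * n)).sym2 \ (box d n).sym2) ∈ annulusCrossing d n := by
  obtain ⟨m, hm⟩ : ∃ m : ℕ, m + 1 = 2 * n := ⟨2 * n - 1, by omega⟩
  -- last visit to `Λ_n`
  obtain ⟨a, b, ha, -, hb, hab, hpath⟩ :=
    h.last_exit (C := (↑(box d n) : Set (Site d))) (Finset.mem_coe.2 (zero_mem_box d n))
      (mt Finset.mem_coe.1 (notMem_box_of_mem_innerBoundary_box (by omega) hy))
  have ha2 : a ∈ box d (2 * n) := box_subset_box_two_mul d n ha
  have hb2 : b ∈ box d (2 * n) :=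
    box_mono d (by omega) (DCT16.mem_box_succ_of_adj ha (adj_of_openGraph_adj hω hab))
  have hfirst : PathIn (openGraph (ω ∩ ↑((box d (2 * n)).sym2 \ (box d n).sym2)))
      ↑(box d (2 * n)) a b :=
    PathIn.of_adj ha2 hb2 (openGraph_inter_adj ha2 hb2 (Or.inr hb) hab)
  by_cases hbm : b ∈ (↑(box d m) : Set (Site d))
  · -- first visit to `∂ⁱⁿΛ_{2n}` after `b`: first exit from `Λ_m`, `m + 1 = 2n`
    obtain ⟨a', b', ha', hb', -, hab', hmid⟩ :=
      hpath.exit hbm (mt Finset.mem_coe.1 (notMem_box_of_mem_innerBoundary_box (by omega) hy))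
    have ha'2 : a' ∈ box d (2 * n) := box_mono d (by omega) ha'
    have hb'2 : b' ∈ box d (2 * n) :=
      hm ▸ DCT16.mem_box_succ_of_adj ha' (adj_of_openGraph_adj hω hab')
    have hmid' : PathIn (openGraph (ω ∩ ↑((box d (2 * n)).sym2 \ (box d n).sym2)))
        ↑(box d (2 * n)) b a' :=
      (pathIn_congrGraph (fun u v hu hv huv => openGraph_inter_adj (box_mono d (by omega) hu.1)
        (box_mono d (by omega) hv.1) (Or.inl hu.2.2) huv) hmid).mono
        fun z hz => box_mono d (by omega) hz.1
    exact ⟨a, ha, b', mem_innerBoundary_box_of_notMem hm hb'2 hb',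
      mem_openConnIn_of_pathIn ((hfirst.trans hmid').tail
        (openGraph_inter_adj ha'2 hb'2 (Or.inl hmid.right_mem.2.2) hab') hb'2)⟩
  · exact ⟨a, ha, b, mem_innerBoundary_box_of_notMem hm hb2 hbm, mem_openConnIn_of_pathIn hfirst⟩

/-! ### The multi-scale product bound -/

/-- **Multi-scale product bound for the one-arm probability** (every `d`, every `p`, every `K`):
`π_p(2^K) ≤ Π_{j<K} P_p(annulusCrossing d (2^j))`. The pure crossing events
`A_j = {ω | ω ∩ (Λ_{2^{j+1}}.sym2 ∖ Λ_{2^j}.sym2) ∈ annulusCrossing d (2^j)}` are independent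
(`real_biInter_range_eq_prod` along the filtration `j ↦ Λ_{2^j}.sym2`), contain the arm event
`{0 ↔ ∂ⁱⁿΛ_{2^K} in Λ_{2^K}}` for `j < K` (a.s., `mem_annulusCrossing_inter_of_pathIn`), and
`A_j ⊆ annulusCrossing d (2^j)`. -/
theorem oneArmProb_two_pow_le_prod (p : unitInterval) (K : ℕ) :
    oneArmProb d p (2 ^ K) ≤
      ∏ j ∈ Finset.range K, (bondPercolation (zdGraph d) p).real (annulusCrossing d (2 ^ j)) := by
  have hF : Monotone fun j : ℕ => (box d (2 ^ j)).sym2 := fun i j hij =>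
    Finset.sym2_mono (box_mono d (Nat.pow_le_pow_right two_pos hij))
  calc oneArmProb d p (2 ^ K)
      ≤ (bondPercolation (zdGraph d) p).real (⋂ j ∈ Finset.range K,
          {ω | ω ∩ ↑((box d (2 ^ (j + 1))).sym2 \ (box d (2 ^ j)).sym2) ∈
            annulusCrossing d (2 ^ j)}) := by
        refine real_mono_of_forall_subset_edgeSet (zdGraph d) p fun ω hω h => ?_
        obtain ⟨y, hy, hpath⟩ := mem_siteToBoundary_iff.1 h
        refine Set.mem_iInter₂.2 fun j hj => ?_
        have hjK : 2 ^ (j + 1) ≤ 2 ^ K := Nat.pow_le_pow_right two_pos (Finset.mem_range.1 hj)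
        rw [pow_succ'] at hjK ⊢
        exact mem_annulusCrossing_inter_of_pathIn Nat.one_le_two_pow hjK hω hy hpath
    _ = ∏ j ∈ Finset.range K, (bondPercolation (zdGraph d) p).real
          {ω | ω ∩ ↑((box d (2 ^ (j + 1))).sym2 \ (box d (2 ^ j)).sym2) ∈
            annulusCrossing d (2 ^ j)} :=
        real_biInter_range_eq_prod (zdGraph d) p hF
          (A := fun j => {ω | ω ∩ ↑((box d (2 ^ (j + 1))).sym2 \ (box d (2 ^ j)).sym2) ∈
            annulusCrossing d (2 ^ j)})
          (fun j => determinedBy_setOf_inter_mem _ _) K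
    _ ≤ ∏ j ∈ Finset.range K, (bondPercolation (zdGraph d) p).real (annulusCrossing d (2 ^ j)) :=
        Finset.prod_le_prod (fun _ _ => measureReal_nonneg) fun j _ =>
          measureReal_mono (setOf_inter_mem_subset (isUpperSet_annulusCrossing d _) _)

/-- **Exponential form**: `π_p(2^K) ≤ exp(-Σ_{j<K} u_{2^j}(p))`, `u_n(p) = blockProb d p n =
1 - P_p(annulusCrossing d n)`, from `oneArmProb_two_pow_le_prod` and `1 - u ≤ e^{-u}`. -/
theorem oneArmProb_two_pow_le_exp (p : unitInterval) (K : ℕ) :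
    oneArmProb d p (2 ^ K) ≤ Real.exp (-∑ j ∈ Finset.range K, blockProb d p (2 ^ j)) := by
  calc oneArmProb d p (2 ^ K)
      ≤ ∏ j ∈ Finset.range K, (bondPercolation (zdGraph d) p).real (annulusCrossing d (2 ^ j)) :=
        oneArmProb_two_pow_le_prod p K
    _ = ∏ j ∈ Finset.range K, (1 - blockProb d p (2 ^ j)) :=
        Finset.prod_congr rfl fun j _ => by rw [blockProb_eq]; ring
    _ ≤ ∏ j ∈ Finset.range K, Real.exp (-blockProb d p (2 ^ j)) :=
        Finset.prod_le_prod (fun j _ => sub_nonneg.2 (blockProb_le_one d p _)) fun j _ =>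
          Real.one_sub_le_exp_neg _
    _ = Real.exp (-∑ j ∈ Finset.range K, blockProb d p (2 ^ j)) := by
        rw [← Finset.sum_neg_distrib, Real.exp_sum]

/-! ### Analysis: from the dyadic scales to every `m ≥ 1` -/

/-- `e^{-t} ≤ (2^K)^{-c}` for `t = cK`, `0 ≤ c` (since `2 ≤ e`). -/
theorem exp_neg_mul_le_two_pow_rpow_neg {c : ℝ} (hc : 0 ≤ c) (K : ℕ) :
    Real.exp (-(c * K)) ≤ ((2 : ℝ) ^ K) ^ (-c) := by
  rw [← Real.exp_one_rpow, ← Real.rpow_natCast_mul (by norm_num : (0 : ℝ) ≤ 2),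
    show ((K : ℕ) : ℝ) * -c = -(c * K) by ring]
  exact Real.rpow_le_rpow_of_nonpos (by norm_num) (by linarith [Real.add_one_le_exp (1 : ℝ)])
    (neg_nonpos.2 (mul_nonneg hc (Nat.cast_nonneg K)))

/-- **Dyadic interpolation.** If `π_p(2^K) ≤ e^{-cK}` for all `K ≥ K₀` (`0 ≤ c`), then for every
`m ≥ 1`, `π_p(m) ≤ (2^c + (2^{K₀})^c) · m^{-c}`: with `2^K ≤ m < 2^{K+1}` (`K = Nat.log 2 m`), either
`K ≥ K₀` and `π_p(m) ≤ π_p(2^K) ≤ e^{-cK} ≤ (2^K)^{-c} ≤ 2^c m^{-c}` (`m ↦ π_p(m)` is antitone,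
`DCT16.real_siteToBoundary_antitone`), or `m < 2^{K₀}` and `π_p(m) ≤ 1 ≤ (2^{K₀})^c m^{-c}`. -/
theorem oneArmProb_le_of_two_pow (p : unitInterval) {c : ℝ} (hc : 0 ≤ c) {K₀ : ℕ}
    (h : ∀ K : ℕ, K₀ ≤ K → oneArmProb d p (2 ^ K) ≤ Real.exp (-(c * K))) {m : ℕ} (hm : 1 ≤ m) :
    oneArmProb d p m ≤ ((2 : ℝ) ^ c + ((2 : ℝ) ^ K₀) ^ c) * (m : ℝ) ^ (-c) := by
  have hm0 : (0 : ℝ) < m := Nat.cast_pos.2 (Nat.succ_le_iff.1 hm)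
  have hms : 0 ≤ (m : ℝ) ^ (-c) := Real.rpow_nonneg hm0.le _
  have h2c : 0 ≤ (2 : ℝ) ^ c := Real.rpow_nonneg (by norm_num) _
  have hK₀c : 0 ≤ ((2 : ℝ) ^ K₀) ^ c := Real.rpow_nonneg (by positivity) _
  set K := Nat.log 2 m with hK
  have hKm : 2 ^ K ≤ m := Nat.pow_log_le_self 2 (by omega)
  have hmK : m < 2 ^ (K + 1) := Nat.lt_pow_succ_log_self one_lt_two m
  rcases le_or_gt K₀ K with hle | hlt
  · -- large `m`: compare with the dyadic scale `2^K ≤ m < 2 · 2^K`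
    have h2K : (0 : ℝ) < (2 : ℝ) ^ K := by positivity
    have hm2 : (m : ℝ) ≤ 2 * (2 : ℝ) ^ K := by
      have : m ≤ 2 * 2 ^ K := by rw [← pow_succ']; exact hmK.le
      exact_mod_cast this
    calc oneArmProb d p m ≤ oneArmProb d p (2 ^ K) := real_siteToBoundary_antitone p hKm
      _ ≤ Real.exp (-(c * K)) := h K hle
      _ ≤ ((2 : ℝ) ^ K) ^ (-c) := exp_neg_mul_le_two_pow_rpow_neg hc K
      _ ≤ (2 : ℝ) ^ c * (m : ℝ) ^ (-c) := rpow_neg_le_of_le_mul hc hm0 two_pos h2K hm2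
      _ ≤ ((2 : ℝ) ^ c + ((2 : ℝ) ^ K₀) ^ c) * (m : ℝ) ^ (-c) :=
          mul_le_mul_of_nonneg_right (le_add_of_nonneg_right hK₀c) hms
  · -- small `m`: `π ≤ 1 ≤ (2^{K₀})^c m^{-c}`
    have hmK₀ : (m : ℝ) ≤ (2 : ℝ) ^ K₀ * 1 := by
      have : m ≤ 2 ^ K₀ := hmK.le.trans (Nat.pow_le_pow_right two_pos (Nat.succ_le_of_lt hlt))
      rw [mul_one]
      exact_mod_cast this
    calc oneArmProb d p m ≤ 1 := measureReal_le_one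
      _ = (1 : ℝ) ^ (-c) := (Real.one_rpow _).symm
      _ ≤ ((2 : ℝ) ^ K₀) ^ c * (m : ℝ) ^ (-c) :=
          rpow_neg_le_of_le_mul hc hm0 (by positivity) one_pos hmK₀
      _ ≤ ((2 : ℝ) ^ c + ((2 : ℝ) ^ K₀) ^ c) * (m : ℝ) ^ (-c) :=
          mul_le_mul_of_nonneg_right (le_add_of_nonneg_left h2c) hms

end CesaroBlockingGivesOneArm

open CesaroBlockingGivesOneArm in
/-- **Registered stub `stub_cesaroBlockingGivesOneArm`** (crux stmt-CriticalPhenomena-4447, line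
`Sketch_r2_ideator4`): Cesàro blocking at `p` ⟹ polynomial one-arm decay at `p`, for EVERY `p`.
With `u_n = P_p(Λ_n ↮ ∂ⁱⁿΛ_{2n} in Λ_{2n})` (`= blockProb 3 p n`): if eventually
`c K ≤ Σ_{j<K} u_{2^j}` (`c > 0`), then by the multi-scale product bound
`π_p(2^K) ≤ Π_{j<K} (1 - u_{2^j}) ≤ exp(-Σ_{j<K} u_{2^j}) ≤ e^{-cK}` for `K ≥ K₀`
(`oneArmProb_two_pow_le_exp`), and dyadic interpolation (`oneArmProb_le_of_two_pow`) gives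
`π_p(m) ≤ (2^c + (2^{K₀})^c) m^{-c}` for all `m ≥ 1`; so `s = c`. -/
theorem stub_cesaroBlockingGivesOneArm :
    ∀ p : unitInterval,
      (∃ c : ℝ, 0 < c ∧ ∀ᶠ K : ℕ in atTop, c * (K : ℝ) ≤
        ∑ j ∈ Finset.range K, (bondPercolation (zdGraph 3) p).real
          {ω | ¬ ∃ x ∈ box 3 (2 ^ j), ∃ y ∈ innerBoundary (zdGraph 3) (box 3 (2 * 2 ^ j)),
            ω ∈ openConnIn (↑(box 3 (2 * 2 ^ j)) : Set (Site 3)) x y}) →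
      ∃ s C : ℝ, 0 < s ∧ ∀ m : ℕ, 1 ≤ m → oneArmProb 3 p m ≤ C * (m : ℝ) ^ (-s) := by
  rintro p ⟨c, hc, hev⟩
  obtain ⟨K₀, hK₀⟩ := eventually_atTop.1 hev
  -- the summand is `blockProb 3 p (2^j) = P_p((annulusCrossing 3 (2^j))ᶜ)` (definitional)
  have hK₀' : ∀ K : ℕ, K₀ ≤ K → c * (K : ℝ) ≤ ∑ j ∈ Finset.range K, blockProb 3 p (2 ^ j) := hK₀
  refine ⟨c, (2 : ℝ) ^ c + ((2 : ℝ) ^ K₀) ^ c, hc, fun m hm => ?_⟩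
  refine oneArmProb_le_of_two_pow p hc.le (fun K hK => ?_) hm
  calc oneArmProb 3 p (2 ^ K) ≤ Real.exp (-∑ j ∈ Finset.range K, blockProb 3 p (2 ^ j)) :=
        oneArmProb_two_pow_le_exp p K
    _ ≤ Real.exp (-(c * K)) := Real.exp_le_exp.2 (neg_le_neg (hK₀' K hK))

end Summit.CriticalPhenomena.PercolationContinuityZ3.FreeBoxPowerSavingLine

end
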